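import Summits.QuantumFields.YangMills.Theorems.FluctuationComparisonRegPrIntLS2BetaDiscEnergyPerBlockOfLetters
import Summits.QuantumFields.YangMills.Theorems.FluctuationComparisonRegPrIntLS2BetaLiftLadderRowsDock
import Summits.QuantumFields.YangMills.Theorems.FluctuationComparisonRegPrIntLS2BetaCentralFaceLetters
import Summits.QuantumFields.YangMills.Theorems.FluctuationComparisonRegPrIntLS2BetaRelativeStokes
import Literature.MathematicalPhysics.QuantumFieldTheory.Balaban1983to89.B12GaugeOrbits021
import HarnessLib

/-!
# S2β · THE SUP CHAIN — (SPLIT) AT THE TOWER: the tower edition of the per-`B` discrepancy row, `D′lam t ≤ X t`,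
# with the feedback letter DISCHARGED by the parent READ′ Pi-sup, and its `S′`-share `Σ_t L^t·Σ_B M(t,B)² ≤ L·S′`

Cell `ym3-torus` (rung R3 = continuum `SU(2)` Yang–Mills on the three-torus at fixed lattice data — NOT d = 4, NOT infinite volume, NOT a mass gap, NOT Clay).
Width seat «width 20» `ym3-torus-px20` (gen 24), FREE px helper on crux `stmt-QuantumFields-20520`, LINE g18-1 S2β; the c₃ assembler's TOWER EDITION (architect
px17 g22: 19:37:59Z «px20 keeps the tower edition», 21:37:14Z INDEX CHECK + RULING «β_X», 21:41:45Z «shape YES ×4», 21:44:05Z RULING «ρκ-CURL»).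
`--kind proof --supports stmt-QuantumFields-20520 --as helper`, count-neutral, DEFINITION-FREE (0 `def`, 0 `instance`, 0 `notation`, 0 `sorry`, default heartbeats).

THE ROW.  The station ✓p834059 `supTowerLetter_of_liftLadderFbLetter‴` wants, besides `hTOP`∕`hREC` (✓p835328 `rows_dock`), a budget of `c t := (1+κ⁻¹)·D′lam t`,
`D′lam t` = the letter-free DISCREPANCY ENERGY at family level `J+t+1` (child height `s = K − (J+t+1)` of `F.P K`, parent height `s+1`); px21 g25's (iii)
✓`hSCT_of_discSplit'` reduces it to `hDisc : D′lam t ≤ X t (+ q·E′lam t)` and `hX′ : Σ_t L^t·X t ≤ C_X·e^{c_XΣθ′}·purse + β_X·S′`.  THIS FILE supplies `hDisc` (`q := 0`)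
and the feedback's `S′`-share:
* §1 ★`read'_parent` — the PARENT `⟨blockOf b₋, dir b⟩` of a bond of `READ′_{t+1}(B)` lies in `READ′_t(B)` (witness `blockOf z`; ✓p830803 `natAbs_rel_blockOf_le_one` cited,
  carried across the family as in ✓`read'_nest_of_feeds`).
* §2 ★★★`discRow'` — `∀ t < K − J, D′lam t ht ≤ X t ht`, `X t ht := Σ_B [(1+κ′)·r(t,B)² + (1+κ′⁻¹)·m(t,B)²]`, θ-LETTER part `r := (π∕2)(ρκ t B + (2((L−1)∕2))(2+2((L−1)∕2))ρ̃ t B)`,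
  FEEDBACK part `m := π·(6·((5L)²∕4·a t))·(((L−1)∕2+1)·(11∕10·L⁻¹·M(t,B)))` with **`M(t,B)` = the Pi-sup over READ′ at level `J+t` of the raw relative log of the level-(J+t)
  descended pair — the station's `E′lam (t−1)` summand norm VERBATIM for `t ≥ 1`, `≡ 0` on the fibre at `t = 0`**.  Per `B` the row is px5 g23 ✓ Q11l
  `sq_pi_norm_disc_trunc_le_source_add_feedback` (✓p833084 ∘ ✓p834979 ∘ ✓p834378 + the split `(r+m)² ≤ (1+κ′)r² + (1+κ′⁻¹)m²`) at `(F.P K, s, ℰp, READ′_t(B)∘bondShift)`,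
  letters inhabited thus: `ρκ` (RELATIVE (0.4) correction factor over the block pair) — HYPOTHESIS `hκrel`, to be SUPPLIED IN c₁'s FINE-RELATIVE-PLAQUETTE CURRENCY AT
  LEVEL t (RULING «ρκ-CURL»; W-STOKES px13 g28, W-ρκ px16 g24), not an oscillation letter; `aκ := 6·((5L)²∕4·a t)` by lit ✓`dist1_corr_le` from the STAGE PLAQUETTE
  class `hplaq : PlaqSmall (a t) (Ū^sU₀)` ((BKG)'s object, gauge-moved by ✓`iter_eq_of_bottom` + lit ✓`plaqSmall_gaugeAct_iff'`) + `hthr`; `mR := 11∕10·L⁻¹·M(t,B)` by the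
  ARC PROFILE at the parent height (✓p832421 `norm_logVec_liftChord_le_eleven_tenths`, ✓p835260 `feeder_b0`, ✓p834378 `centralBond_eq_b0`,
  ✓`norm_logVec_rawChord_eq_stageChord`, §1) for `t ≥ 1` and by ✓p835328 `stageTop_eq_of_fibreMate` (the relative lift is `1`) at `t = 0`; `ρ̃` — HYPOTHESIS `hρ`
  (px12 g26 (d)); (T5)×2 from (T3)×2; the commutator letter by ✓`dist1_comm_le_SU`.  Binders = ✓`rows_dock`'s + `ρκ ρ̃ : ℕ → PBond (F.P J) 0 → ℝ`, `a : ℕ → ℝ`.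
* §3 ★★`mShare_le` — RULING «β_X» (b): `Σ_{t<K−J} L^t·Σ_B M(t,B)² ≤ L·S′` (`S′` the station's READ′ sum VERBATIM; the `t+1` summand IS `L·(L^t·E′lam t)`, the `t = 0`
  one vanishes by `hmate`) — so (iii) ed.2's `hX′` takes `β_X := (1+κ′⁻¹)(π·6((5L)²∕4·ā)((L−1)∕2+1)(11∕10))²·L⁻¹` from the `m²`-column and the `r²`-column from the
  `ρκ`∕`ρ̃` budgets (px16 g24 W-ρκ ∕ px10 g26 c₁ core ∕ px12 g26 (d)).

HONEST SCOPE.  Σ_B∕`bondShift` plumbing over landed per-`B` lemmas; `ρκ`, `ρ̃`, `a`, the arc profile `hArc`, the `AxStage` clauses, (BKG), every budget, (ST‴)∕LOC‴, `h3`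
are HYPOTHESES or other seats'; nothing of Bałaban's renormalisation-group analysis is asserted or proved ([Balaban1985Averaging] Prop. 4 (128)–(135) pp.37–38,
[Balaban1985RegularSpaces] (1.19) p.79, (1.29) p.81, [Balaban1987RG1] (0.3)–(0.4) pp.252–253, (0.11) p.253 are the printed objects transcribed); GAP♯∘
(`stub_uniformFibreGapOrbit`, registry 3732b7df UNTOUCHED), the five registered stubs (0∕5), S2β, 20520, 19936, 19200, `YM3TorusSU2` NOT proved; no registered stub
is closed; rung R3 — NOT d = 4, NOT infinite volume, NOT a mass gap, NOT Clay; the Yang–Mills mass gap is NOT proved.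
-/

set_option autoImplicit false

namespace Summit.QuantumFields.YangMills.Theorems.FluctuationComparisonRegPrIntLS2BetaLiftLadderDiscRowTower

open scoped Real
open Literature.MathematicalPhysics.QuantumLattice (su2Quat)
open Literature.MathematicalPhysics.QuantumFieldTheory.Balaban1983to89
open T4Continuum T3ContinuumYM3Torus T3TiltDescent T3LevelShift BlockAveraging AveragingRT B10Eq47AxialChi
open B10Eq27TorusAxialLog (rel axialT transl)
open T4CubeChartGnomonic (SU2)
open T4HaarSU2ExpChart (expPoint)
open T4ExpWindowSmallField (logVec)
open ExpMeanLog (deltaSU)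
open T3UnitLawDensityEML (ℰp)
open B12SmallFieldDomain259 (b0)
open BlockAveragingPlaquetteBound (dist1_corr_le)
open Summit.QuantumFields.YangMills.Theorems.FluctuationComparisonRegPrIntLS2BetaLiftLadderCombRow (norm_logVec_rawChord_eq_stageChord iter_eq_of_bottom)
open Summit.QuantumFields.YangMills.Theorems.FluctuationComparisonRegPrIntLS2BetaLiftLadderCombRowTower
  (descendTo_apply_eq_iter_of_eq treeComb_siteShift natAbs_rel_siteShift siteShift_siteShift_symm siteShift_symm_siteShift)
open Summit.QuantumFields.YangMills.Theorems.FluctuationComparisonRegPrIntLS2BetaSupTowerOfLiftLadderNested (blockIter_succ_eq_siteShift)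
open Summit.QuantumFields.YangMills.Theorems.FluctuationComparisonRegPrIntLS2BetaReadNesting (natAbs_rel_blockOf_le_one)
open Summit.QuantumFields.YangMills.Theorems.FluctuationComparisonRegPrIntLS2BetaGeodesicJensenLift (dist1_le_norm_logVec)
open Summit.QuantumFields.YangMills.Theorems.FluctuationComparisonRegPrIntLS2BetaLiftLadderFaceRow (norm_logVec_liftChord_le_eleven_tenths)
open Summit.QuantumFields.YangMills.Theorems.FluctuationComparisonRegPrIntLS2BetaCentralFaceDiscrepancyDock (centralBond_eq_b0)
open Summit.QuantumFields.YangMills.Theorems.FluctuationComparisonRegPrIntLS2BetaCentralFaceLetters (feeder_b0)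
open Summit.QuantumFields.YangMills.Theorems.FluctuationComparisonRegPrIntLS2BetaLiftLadderRowsDock (stageTop_eq_of_fibreMate)
open Summit.QuantumFields.YangMills.Theorems.FluctuationComparisonRegPrIntLS2BetaDiscEnergyPerBlockOfLetters (sq_pi_norm_disc_trunc_le_source_add_feedback)
open Summit.QuantumFields.YangMills.Theorems.FluctuationComparisonRegPrIntLS2BetaRelativeStokes (dist1_comm_le_SU)

/-! ## §1 The parent of a READ′ bond is a READ′ bond one family down -/

section Parent

variable {F : T3Family}

/-- ★ **THE PARENT OF A `READ′_{t+1}(B)` BOND LIES IN `READ′_t(B)`.**  Levels: the fine bond `ℓ″` at level `0` of `F.P (n+1)` (its `F.P K`-copy `σ₂ ℓ″` at height `s`,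
`hs`), its PARENT `⟨blockOf (σ₂ ℓ″)₋, dir⟩` at height `s+1` of `F.P K`, read back at level `0` of `F.P n` through `σ₁` (`hs1`).  If `z` is a thickness-2 witness for `ℓ″`
then `y := σ⁻¹(blockOf z)` satisfies `blockOf z = σ y` (the hypothesis shape of ✓`blockIter_succ_eq_siteShift`) and is a thickness-2 witness for the parent:
`|rel y (σ₁⁻¹ parent)₋|_ν = |rel (blockOf σ₂z) (blockOf (σ₂ℓ″)₋)|_ν ≤ 1` (✓p830803 `natAbs_rel_blockOf_le_one`, `2 ≤ L`). [cite: Balaban1985RegularSpaces, (1.29) p.81; Balaban1987RG1, (0.1)-(0.4) p.251-253] -/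
theorem read'_parent {n K s : ℕ} (hs : F.m + (n + 1) + s = F.m + K + 0) (hs1 : F.m + n + (s + 1) = F.m + K + 0)
    (hsK : s + 1 ≤ (F.P K).m + (F.P K).K) (ℓ'' : PBond (F.P (n + 1)) 0)
    {z : Site (F.P (n + 1)) 0} (hz : ∀ ν, (rel z ℓ''.src ν).natAbs ≤ 2) :
    blockOf z = siteShift (F.sitesPerDir_eq (m := F.m) (K := n) (j := 0) (m' := F.m) (K' := n + 1) (j' := 1) (by omega))
        (siteShift (F.sitesPerDir_eq (m := F.m) (K := n) (j := 0) (m' := F.m) (K' := n + 1) (j' := 1) (by omega)).symm (blockOf z)) ∧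
      ∀ ν, (rel (siteShift (F.sitesPerDir_eq (m := F.m) (K := n) (j := 0) (m' := F.m) (K' := n + 1) (j' := 1) (by omega)).symm (blockOf z))
        ((bondShift (F.sitesPerDir_eq hs1)).symm ⟨blockOf (bondShift (F.sitesPerDir_eq hs) ℓ'').src, (bondShift (F.sitesPerDir_eq hs) ℓ'').dir⟩).src ν).natAbs ≤ 2 := by
  refine ⟨(siteShift_siteShift_symm _ _).symm, fun ν => ?_⟩
  have hs1' : (F.PP F.m (n + 1)).sitesPerDir 1 = (F.PP F.m K).sitesPerDir (s + 1) := F.sitesPerDir_eq (by omega)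
  have h2L : 2 ≤ (F.P K).L := by have := (F.P K).hL.2; have := F.hL; show 2 ≤ F.L; omega
  -- the witness and the source in `F.P K`, heights `s` ∕ `s+1`
  have hzK : (rel (siteShift (F.sitesPerDir_eq hs) z) (bondShift (F.sitesPerDir_eq hs) ℓ'').src ν).natAbs ≤ (F.P K).L := by
    rw [bondShift_src, natAbs_rel_siteShift]; exact (hz ν).trans h2L
  have hK := natAbs_rel_blockOf_le_one hsK (siteShift (F.sitesPerDir_eq hs) z) (bondShift (F.sitesPerDir_eq hs) ℓ'').src ν hzK
  -- read the pair through `σ₁` (height `s+1` of `F.P K`)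
  rw [← natAbs_rel_siteShift (F.sitesPerDir_eq hs1), siteShift_siteShift]
  erw [siteShift_blockOf (F.sitesPerDir_eq hs) hs1' z, Equiv.apply_symm_apply]
  exact hK.trans (by norm_num)

end Parent

/-! ## §2 The discrepancy row at the tower: `D′lam t ≤ X t`, feedback letter discharged by the parent READ′ Pi-sup -/

section Tower

variable {F : T3Family}

/-- ★★★ **(SPLIT) AT THE TOWER — THE TOWER EDITION OF THE PER-`B` DISCREPANCY ROW.**  For every `t < K − J`: `D′lam t ht ≤ X t ht` with `D′lam` the station's ∕
✓`rows_dock`'s letter-free discrepancy energy VERBATIM and `X t ht = Σ_B [(1+κ′)·r(t,B)² + (1+κ′⁻¹)·m(t,B)²]` EXPLICIT (module docstring): the θ-letters `ρκ t B`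
(relative (0.4) correction factor over the block pair — supplied in c₁'s fine-relative-plaquette currency at level t, RULING «ρκ-CURL») and `ρ̃ t B` (relative
plaquettes) stay HYPOTHESES as functions `ℕ → PBond (F.P J) 0 → ℝ`, the stage plaquette class `a t` per level; the feedback letter is DISCHARGED by the PARENT READ′
Pi-sup `M(t,B)` (one text for all `t`; at `t = 0` its object is `≡ 1` on the fibre).  Per `B`: px5 ✓`sq_pi_norm_disc_trunc_le_source_add_feedback` at
`(F.P K, s, ℰp, READ′_t(B)∘bondShift)`; `aκ` by lit ✓`dist1_corr_le`; `mR` by the arc profile at the parent height (`t ≥ 1`, §1) ∕ by ✓`stageTop_eq_of_fibreMate` (`t = 0`).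
[cite: Balaban1985RegularSpaces, (1.19) p.79, (1.29) p.81; Balaban1985Averaging, Prop. 4 (128)-(135) p.37-38; Balaban1987RG1, (0.3)-(0.4) p.252-253, (0.11) p.253] -/
theorem discRow'
    {J K : ℕ} (hJK : J ≤ K) (U₀ : GaugeField (F.P K) 0 (Matrix.specialUnitaryGroup (Fin 2) ℂ)) (ζ : PBond (F.P K) 0 → EuclideanSpace ℝ (Fin 3))
    (wt : (j : ℕ) → PBond (F.P K) j → PBond (F.P K) (j + 1) → ℝ)
    (lift : (j : ℕ) → GaugeField (F.P K) (j + 1) SU2 → GaugeField (F.P K) j SU2)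
    (U₁ : GaugeField (F.P K) 0 SU2) (g g₀ : (j : ℕ) → Site (F.P K) j → SU2)
    (hwt : ∀ j b e, wt j b e = if e.dir = b.dir ∧ (b.src b.dir - emb e.src b.dir).val < (F.P K).L then
        ∏ ν ∈ Finset.univ.erase b.dir, max 0 (1 - ((rel (emb e.src) b.src ν).natAbs : ℝ) / (F.P K).L) else 0)
    (hlift : ∀ j X b, lift j X b = expPoint (∑ e, wt j b e • ((((F.P K).L : ℕ) : ℝ)⁻¹ • logVec (su2Quat (X e)))))
    (hT3 : ∀ X : GaugeField (F.P K) 0 SU2, ∀ j, j ≤ K - J →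
      Averaging.iter (fun k => blockAvg (P := F.P K) (j := k) ℰp) j (GaugeField.gaugeAct (g 0) X) =
        GaugeField.gaugeAct (g j) (Averaging.iter (fun k => blockAvg (P := F.P K) (j := k) ℰp) j X))
    (hT4 : ∀ j, j < K - J → ∀ x,
      axialT (GaugeField.gaugeAct (g j) (Averaging.iter (fun k => blockAvg (P := F.P K) (j := k) ℰp) j (fun ℓ => expPoint (ζ ℓ) * U₀ ℓ))) (emb (blockOf x)) x =
        axialT (lift j (GaugeField.gaugeAct (g (j + 1)) (Averaging.iter (fun k => blockAvg (P := F.P K) (j := k) ℰp) (j + 1) (fun ℓ => expPoint (ζ ℓ) * U₀ ℓ))))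
          (emb (blockOf x)) x)
    (hT3' : ∀ X : GaugeField (F.P K) 0 SU2, ∀ j, j ≤ K - J →
      Averaging.iter (fun k => blockAvg (P := F.P K) (j := k) ℰp) j (GaugeField.gaugeAct (g₀ 0) X) =
        GaugeField.gaugeAct (g₀ j) (Averaging.iter (fun k => blockAvg (P := F.P K) (j := k) ℰp) j X))
    (hT4' : ∀ j, j < K - J → ∀ x,
      axialT (GaugeField.gaugeAct (g₀ j) (Averaging.iter (fun k => blockAvg (P := F.P K) (j := k) ℰp) j U₁)) (emb (blockOf x)) x =
        axialT (lift j (GaugeField.gaugeAct (g₀ (j + 1)) (Averaging.iter (fun k => blockAvg (P := F.P K) (j := k) ℰp) (j + 1) U₁)))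
          (emb (blockOf x)) x)
    (hU₀ : U₀ = GaugeField.gaugeAct (fun x => (g 0 x)⁻¹ * g₀ 0 x) U₁)
    (hL2 : 2 ≤ F.L) {σ : ℝ} (hσ4 : σ ≤ 1 / 4)
    (hArc : ∀ i, 1 ≤ i → i < K - J → ∀ e : PBond (F.P K) i,
      ‖logVec (su2Quat (GaugeField.gaugeAct (g i) (Averaging.iter (fun k => blockAvg (P := F.P K) (j := k) ℰp) i (fun ℓ => expPoint (ζ ℓ) * U₀ ℓ)) e))‖ ≤ σ ∧
      ‖logVec (su2Quat (GaugeField.gaugeAct (g₀ i) (Averaging.iter (fun k => blockAvg (P := F.P K) (j := k) ℰp) i U₁) e))‖ ≤ σ)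
    (hg1 : ∀ j, K - J ≤ j → ∀ y, g j y = 1) (hg1' : ∀ j, K - J ≤ j → ∀ y, g₀ j y = 1)
    (hT6 : ∀ X : GaugeField (F.P K) 0 SU2, Averaging.iter (fun k => blockAvg (P := F.P K) (j := k) ℰp) (K - J) (GaugeField.gaugeAct (fun x => (g 0 x)⁻¹) X) = Averaging.iter (fun k => blockAvg (P := F.P K) (j := k) ℰp) (K - J) X)
    (hT5r : ∀ X : GaugeField (F.P K) 0 SU2, Averaging.iter (fun k => blockAvg (P := F.P K) (j := k) ℰp) (K - J) (GaugeField.gaugeAct (g₀ 0) X) = Averaging.iter (fun k => blockAvg (P := F.P K) (j := k) ℰp) (K - J) X)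
    (hmate : descendTo F ℰp J K hJK (fun ℓ => expPoint (ζ ℓ) * U₀ ℓ : GaugeField (F.P K) 0 (Matrix.specialUnitaryGroup (Fin 2) ℂ)) = descendTo F ℰp J K hJK U₀)
    (ρκ ρt : ℕ → PBond (F.P J) 0 → ℝ) (a : ℕ → ℝ) (hρκ0 : ∀ t B, 0 ≤ ρκ t B) (hρt0 : ∀ t B, 0 ≤ ρt t B) (ha0 : ∀ t, 0 ≤ a t)
    (hplaq : ∀ t, t < K - J → PlaqSmall (a t) (Averaging.iter (fun k => blockAvg (P := F.P K) (j := k) ℰp) (K - (J + (t + 1))) U₀))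
    (hthr : ∀ t, t < K - J → ((((5 * F.L : ℕ) : ℝ)) ^ 2 / 4) * a t < deltaSU (Fin 2))
    (hκrel : ∀ (t : ℕ) (ht : t < K - J) (B : PBond (F.P J) 0) (ℓ' : PBond (F.P (J + (t + 1))) 0), (∃ z : Site (F.P (J + (t + 1))) 0,
                (B14.Eq22Determines.blockIter (t + 1) z = (bondShift (F.sitesPerDir_eq (m := F.m) (K := J) (j := 0) (m' := F.m) (K' := J + (t + 1)) (j' := t + 1) (by omega)) B).src ∨ B14.Eq22Determines.blockIter (t + 1) z = (bondShift (F.sitesPerDir_eq (m := F.m) (K := J) (j := 0) (m' := F.m) (K' := J + (t + 1)) (j' := t + 1) (by omega)) B).tgt) ∧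
                ∀ ν, (B10Eq27TorusAxialLog.rel z ℓ'.src ν).natAbs ≤ 2) →
      blockOf ((bondShift (F.sitesPerDir_eq (m := F.m) (K := J + (t + 1)) (j := 0) (m' := F.m) (K' := K) (j' := (K - (J + (t + 1)))) (by omega)) ℓ').src.shift (bondShift (F.sitesPerDir_eq (m := F.m) (K := J + (t + 1)) (j := 0) (m' := F.m) (K' := K) (j' := (K - (J + (t + 1)))) (by omega)) ℓ').dir) ≠ blockOf (bondShift (F.sitesPerDir_eq (m := F.m) (K := J + (t + 1)) (j := 0) (m' := F.m) (K' := K) (j' := (K - (J + (t + 1)))) (by omega)) ℓ').src →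
      dist1 (corr ℰp (GaugeField.gaugeAct (g (K - (J + (t + 1)))) (Averaging.iter (fun k => blockAvg (P := F.P K) (j := k) ℰp) (K - (J + (t + 1))) (fun ℓ => expPoint (ζ ℓ) * U₀ ℓ))) ⟨blockOf (bondShift (F.sitesPerDir_eq (m := F.m) (K := J + (t + 1)) (j := 0) (m' := F.m) (K' := K) (j' := (K - (J + (t + 1)))) (by omega)) ℓ').src, (bondShift (F.sitesPerDir_eq (m := F.m) (K := J + (t + 1)) (j := 0) (m' := F.m) (K' := K) (j' := (K - (J + (t + 1)))) (by omega)) ℓ').dir⟩ *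
        (corr ℰp (GaugeField.gaugeAct (g₀ (K - (J + (t + 1)))) (Averaging.iter (fun k => blockAvg (P := F.P K) (j := k) ℰp) (K - (J + (t + 1))) U₁)) ⟨blockOf (bondShift (F.sitesPerDir_eq (m := F.m) (K := J + (t + 1)) (j := 0) (m' := F.m) (K' := K) (j' := (K - (J + (t + 1)))) (by omega)) ℓ').src, (bondShift (F.sitesPerDir_eq (m := F.m) (K := J + (t + 1)) (j := 0) (m' := F.m) (K' := K) (j' := (K - (J + (t + 1)))) (by omega)) ℓ').dir⟩)⁻¹) ≤ ρκ t B)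
    (hρ : ∀ (t : ℕ) (ht : t < K - J) (B : PBond (F.P J) 0) (q : Plaq (F.P K) (K - (J + (t + 1)))),
      (∃ ℓ' : PBond (F.P (J + (t + 1))) 0, (∃ z : Site (F.P (J + (t + 1))) 0,
                (B14.Eq22Determines.blockIter (t + 1) z = (bondShift (F.sitesPerDir_eq (m := F.m) (K := J) (j := 0) (m' := F.m) (K' := J + (t + 1)) (j' := t + 1) (by omega)) B).src ∨ B14.Eq22Determines.blockIter (t + 1) z = (bondShift (F.sitesPerDir_eq (m := F.m) (K := J) (j := 0) (m' := F.m) (K' := J + (t + 1)) (j' := t + 1) (by omega)) B).tgt) ∧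
                ∀ ν, (B10Eq27TorusAxialLog.rel z ℓ'.src ν).natAbs ≤ 2) ∧
        (blockOf q.src = blockOf (bondShift (F.sitesPerDir_eq (m := F.m) (K := J + (t + 1)) (j := 0) (m' := F.m) (K' := K) (j' := (K - (J + (t + 1)))) (by omega)) ℓ').src ∨ blockOf q.src = (blockOf (bondShift (F.sitesPerDir_eq (m := F.m) (K := J + (t + 1)) (j := 0) (m' := F.m) (K' := K) (j' := (K - (J + (t + 1)))) (by omega)) ℓ').src).shift (bondShift (F.sitesPerDir_eq (m := F.m) (K := J + (t + 1)) (j := 0) (m' := F.m) (K' := K) (j' := (K - (J + (t + 1)))) (by omega)) ℓ').dir)) →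
      dist1 ((GaugeField.plaqHol (fun b => lift (K - (J + (t + 1))) (GaugeField.gaugeAct (g ((K - (J + (t + 1))) + 1)) (Averaging.iter (fun k => blockAvg (P := F.P K) (j := k) ℰp) ((K - (J + (t + 1))) + 1) (fun ℓ => expPoint (ζ ℓ) * U₀ ℓ))) b *
            (lift (K - (J + (t + 1))) (GaugeField.gaugeAct (g₀ ((K - (J + (t + 1))) + 1)) (Averaging.iter (fun k => blockAvg (P := F.P K) (j := k) ℰp) ((K - (J + (t + 1))) + 1) U₁)) b)⁻¹ *
          (GaugeField.gaugeAct (g₀ (K - (J + (t + 1)))) (Averaging.iter (fun k => blockAvg (P := F.P K) (j := k) ℰp) (K - (J + (t + 1))) U₁)) b : GaugeField (F.P K) (K - (J + (t + 1))) SU2) q)⁻¹ *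
        GaugeField.plaqHol (GaugeField.gaugeAct (g (K - (J + (t + 1)))) (Averaging.iter (fun k => blockAvg (P := F.P K) (j := k) ℰp) (K - (J + (t + 1))) (fun ℓ => expPoint (ζ ℓ) * U₀ ℓ))) q) ≤ ρt t B) {κ' : ℝ} (hκ' : 0 < κ') :
    ∀ (t : ℕ) (ht : t < K - J), (fun (t : ℕ) (ht : t < K - J) => ∑ B : PBond (F.P J) 0,
            ‖(fun ℓ' : PBond (F.P (J + (t + 1))) 0 =>
              if (∃ z : Site (F.P (J + (t + 1))) 0,
                (B14.Eq22Determines.blockIter (t + 1) z = (bondShift (F.sitesPerDir_eq (m := F.m) (K := J) (j := 0) (m' := F.m) (K' := J + (t + 1)) (j' := t + 1) (by omega)) B).src ∨ B14.Eq22Determines.blockIter (t + 1) z = (bondShift (F.sitesPerDir_eq (m := F.m) (K := J) (j := 0) (m' := F.m) (K' := J + (t + 1)) (j' := t + 1) (by omega)) B).tgt) ∧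
                ∀ ν, (B10Eq27TorusAxialLog.rel z ℓ'.src ν).natAbs ≤ 2) ∧
                ¬ (blockOf (ℓ'.src.shift ℓ'.dir) = blockOf ℓ'.src ∧ ∀ ν, ν < ℓ'.dir → B10Eq27TorusAxialLog.rel (emb (blockOf ℓ'.src)) ℓ'.src ν = 0)
              then logVec (su2Quat ((lift (K - (J + (t + 1))) (GaugeField.gaugeAct (g (K - (J + (t + 1)) + 1)) (Averaging.iter (fun k => blockAvg (P := F.P K) (j := k) ℰp) (K - (J + (t + 1)) + 1) (fun ℓ => expPoint (ζ ℓ) * U₀ ℓ))) (bondShift (F.sitesPerDir_eq (m := F.m) (K := J + (t + 1)) (j := 0) (m' := F.m) (K' := K) (j' := (K - (J + (t + 1)))) (by omega)) ℓ') *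
                    (lift (K - (J + (t + 1))) (GaugeField.gaugeAct (g₀ (K - (J + (t + 1)) + 1)) (Averaging.iter (fun k => blockAvg (P := F.P K) (j := k) ℰp) (K - (J + (t + 1)) + 1) U₁)) (bondShift (F.sitesPerDir_eq (m := F.m) (K := J + (t + 1)) (j := 0) (m' := F.m) (K' := K) (j' := (K - (J + (t + 1)))) (by omega)) ℓ'))⁻¹)⁻¹ *
                  (GaugeField.gaugeAct (g (K - (J + (t + 1)))) (Averaging.iter (fun k => blockAvg (P := F.P K) (j := k) ℰp) (K - (J + (t + 1))) (fun ℓ => expPoint (ζ ℓ) * U₀ ℓ)) (bondShift (F.sitesPerDir_eq (m := F.m) (K := J + (t + 1)) (j := 0) (m' := F.m) (K' := K) (j' := (K - (J + (t + 1)))) (by omega)) ℓ') *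
                    (GaugeField.gaugeAct (g₀ (K - (J + (t + 1)))) (Averaging.iter (fun k => blockAvg (P := F.P K) (j := k) ℰp) (K - (J + (t + 1))) U₁) (bondShift (F.sitesPerDir_eq (m := F.m) (K := J + (t + 1)) (j := 0) (m' := F.m) (K' := K) (j' := (K - (J + (t + 1)))) (by omega)) ℓ'))⁻¹))) else 0)‖ ^ 2) t ht ≤
        (fun (t : ℕ) (ht : t < K - J) => ∑ B : PBond (F.P J) 0,
            ((1 + κ') * (π / 2 * (ρκ t B + (((2 * ((F.L - 1) / 2) : ℕ) : ℝ)) * ((2 + 2 * (((F.L - 1) / 2 : ℕ) : ℝ)) * ρt t B))) ^ 2 + (1 + κ'⁻¹) * (π * ((6 * (((((5 * F.L : ℕ) : ℝ)) ^ 2 / 4) * a t)) * ((((F.L - 1) / 2 + 1 : ℕ) : ℝ) * (11 / 10 * ((F.L : ℝ)⁻¹ * ‖(fun ℓ' : PBond (F.P (J + t)) 0 =>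
              if ∃ z : Site (F.P (J + t)) 0,
                (B14.Eq22Determines.blockIter t z = (bondShift (F.sitesPerDir_eq (m := F.m) (K := J) (j := 0) (m' := F.m) (K' := J + t) (j' := t) (by omega)) B).src ∨ B14.Eq22Determines.blockIter t z = (bondShift (F.sitesPerDir_eq (m := F.m) (K := J) (j := 0) (m' := F.m) (K' := J + t) (j' := t) (by omega)) B).tgt) ∧
                ∀ ν, (B10Eq27TorusAxialLog.rel z ℓ'.src ν).natAbs ≤ 2
              then logVec (su2Quat (descendTo F ℰp (J + t) K (by omega) (fun ℓ => expPoint (ζ ℓ) * U₀ ℓ : GaugeField (F.P K) 0 (Matrix.specialUnitaryGroup (Fin 2) ℂ)) ℓ' * (descendTo F ℰp (J + t) K (by omega) U₀ ℓ')⁻¹)) else 0)‖))))) ^ 2)) t ht := by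
  have _h := hJK
  intro t ht
  beta_reduce
  -- heights of `F.P K`: child `s = K − (J+t+1)`, parent `s + 1`
  have hsK : (K - (J + (t + 1))) + 1 ≤ (F.P K).m + (F.P K).K := by show (K - (J + (t + 1))) + 1 ≤ F.m + K; omega
  have hsle : (K - (J + (t + 1))) ≤ K - J := by omega
  have hslt : (K - (J + (t + 1))) < K - J := by omega
  have hs1le : (K - (J + (t + 1))) + 1 ≤ K - J := by omega
  have P₂ : (F.P (J + (t + 1))).sitesPerDir 0 = (F.P K).sitesPerDir (K - (J + (t + 1))) := F.sitesPerDir_eq (by omega)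
  have Q₁ : (F.P (J + (t + 1))).sitesPerDir 1 = (F.P K).sitesPerDir ((K - (J + (t + 1))) + 1) := F.sitesPerDir_eq (by omega)
  have hL2' : 2 ≤ (F.P K).L := hL2
  -- (T5)×2 at height `s` from (T3)×2
  have hT5 : (blockAvg (P := F.P K) (j := (K - (J + (t + 1)))) ℰp).avg (GaugeField.gaugeAct (g (K - (J + (t + 1)))) (Averaging.iter (fun k => blockAvg (P := F.P K) (j := k) ℰp) (K - (J + (t + 1))) (fun ℓ => expPoint (ζ ℓ) * U₀ ℓ))) =
      (GaugeField.gaugeAct (g ((K - (J + (t + 1))) + 1)) (Averaging.iter (fun k => blockAvg (P := F.P K) (j := k) ℰp) ((K - (J + (t + 1))) + 1) (fun ℓ => expPoint (ζ ℓ) * U₀ ℓ))) := by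
    rw [← hT3 (fun ℓ => expPoint (ζ ℓ) * U₀ ℓ) (K - (J + (t + 1))) hsle]
    exact hT3 (fun ℓ => expPoint (ζ ℓ) * U₀ ℓ) ((K - (J + (t + 1))) + 1) hs1le
  have hT5' : (blockAvg (P := F.P K) (j := (K - (J + (t + 1)))) ℰp).avg (GaugeField.gaugeAct (g₀ (K - (J + (t + 1)))) (Averaging.iter (fun k => blockAvg (P := F.P K) (j := k) ℰp) (K - (J + (t + 1))) U₁)) =
      (GaugeField.gaugeAct (g₀ ((K - (J + (t + 1))) + 1)) (Averaging.iter (fun k => blockAvg (P := F.P K) (j := k) ℰp) ((K - (J + (t + 1))) + 1) U₁)) := by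
    rw [← hT3' U₁ (K - (J + (t + 1))) hsle]
    exact hT3' U₁ ((K - (J + (t + 1))) + 1) hs1le
  -- the stage plaquettes of the second tower at height `s`: the gauge move from (BKG)'s object `Ū^s U₀`
  have hplaq' : PlaqSmall (a t) (GaugeField.gaugeAct (g₀ (K - (J + (t + 1)))) (Averaging.iter (fun k => blockAvg (P := F.P K) (j := k) ℰp) (K - (J + (t + 1))) U₁)) := by
    have h := hplaq t ht
    rw [iter_eq_of_bottom (fun k => blockAvg (P := F.P K) (j := k) ℰp) g g₀ U₁ U₀ (fun X => hT3 X (K - (J + (t + 1))) hsle) (fun X => hT3' X (K - (J + (t + 1))) hsle) hU₀] at h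
    exact (B12GaugeOrbits021.plaqSmall_gaugeAct_iff' _ _ _).1 h
  have hthr' : (((((F.P K).d + 2) * (F.P K).L : ℕ) : ℝ) ^ 2 / 4) * a t < deltaSU (Fin 2) := hthr t ht
  have haκ0 : (0 : ℝ) ≤ 6 * ((((((F.P K).d + 2) * (F.P K).L : ℕ) : ℝ) ^ 2 / 4) * a t) := by have := ha0 t; positivity
  have hcomm : ∀ x y : SU2, dist1 (x * y * x⁻¹ * y⁻¹) ≤ 2 * dist1 x * dist1 y := fun x y => dist1_comm_le_SU x y
  classical
  refine Finset.sum_le_sum fun B _ => ?_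
  have hM0 : (0 : ℝ) ≤ 11 / 10 * ((F.L : ℝ)⁻¹ * ‖(fun ℓ' : PBond (F.P (J + t)) 0 =>
              if ∃ z : Site (F.P (J + t)) 0,
                (B14.Eq22Determines.blockIter t z = (bondShift (F.sitesPerDir_eq (m := F.m) (K := J) (j := 0) (m' := F.m) (K' := J + t) (j' := t) (by omega)) B).src ∨ B14.Eq22Determines.blockIter t z = (bondShift (F.sitesPerDir_eq (m := F.m) (K := J) (j := 0) (m' := F.m) (K' := J + t) (j' := t) (by omega)) B).tgt) ∧
                ∀ ν, (B10Eq27TorusAxialLog.rel z ℓ'.src ν).natAbs ≤ 2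
              then logVec (su2Quat (descendTo F ℰp (J + t) K (by omega) (fun ℓ => expPoint (ζ ℓ) * U₀ ℓ : GaugeField (F.P K) 0 (Matrix.specialUnitaryGroup (Fin 2) ℂ)) ℓ' * (descendTo F ℰp (J + t) K (by omega) U₀ ℓ')⁻¹)) else 0)‖) := by positivity
  -- THE LETTERS OF THE PER-`B` ROW at `(F.P K, s, ℰp)` on the pulled-back read predicate `pSK`
  have hκrelK : ∀ b : PBond (F.P K) (K - (J + (t + 1))), (∃ ℓ' : PBond (F.P (J + (t + 1))) 0, (bondShift (F.sitesPerDir_eq (m := F.m) (K := J + (t + 1)) (j := 0) (m' := F.m) (K' := K) (j' := (K - (J + (t + 1)))) (by omega)) ℓ') = b ∧ (∃ z : Site (F.P (J + (t + 1))) 0,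
                (B14.Eq22Determines.blockIter (t + 1) z = (bondShift (F.sitesPerDir_eq (m := F.m) (K := J) (j := 0) (m' := F.m) (K' := J + (t + 1)) (j' := t + 1) (by omega)) B).src ∨ B14.Eq22Determines.blockIter (t + 1) z = (bondShift (F.sitesPerDir_eq (m := F.m) (K := J) (j := 0) (m' := F.m) (K' := J + (t + 1)) (j' := t + 1) (by omega)) B).tgt) ∧
                ∀ ν, (B10Eq27TorusAxialLog.rel z ℓ'.src ν).natAbs ≤ 2)) →
      blockOf (b.src.shift b.dir) ≠ blockOf b.src →
      dist1 (corr ℰp (GaugeField.gaugeAct (g (K - (J + (t + 1)))) (Averaging.iter (fun k => blockAvg (P := F.P K) (j := k) ℰp) (K - (J + (t + 1))) (fun ℓ => expPoint (ζ ℓ) * U₀ ℓ))) ⟨blockOf b.src, b.dir⟩ *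
        (corr ℰp (GaugeField.gaugeAct (g₀ (K - (J + (t + 1)))) (Averaging.iter (fun k => blockAvg (P := F.P K) (j := k) ℰp) (K - (J + (t + 1))) U₁)) ⟨blockOf b.src, b.dir⟩)⁻¹) ≤ ρκ t B := by
    rintro b ⟨ℓ', rfl, hread⟩ hx
    exact hκrel t ht B ℓ' hread hx
  have hκabsK : ∀ b : PBond (F.P K) (K - (J + (t + 1))), (∃ ℓ' : PBond (F.P (J + (t + 1))) 0, (bondShift (F.sitesPerDir_eq (m := F.m) (K := J + (t + 1)) (j := 0) (m' := F.m) (K' := K) (j' := (K - (J + (t + 1)))) (by omega)) ℓ') = b ∧ (∃ z : Site (F.P (J + (t + 1))) 0,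
                (B14.Eq22Determines.blockIter (t + 1) z = (bondShift (F.sitesPerDir_eq (m := F.m) (K := J) (j := 0) (m' := F.m) (K' := J + (t + 1)) (j' := t + 1) (by omega)) B).src ∨ B14.Eq22Determines.blockIter (t + 1) z = (bondShift (F.sitesPerDir_eq (m := F.m) (K := J) (j := 0) (m' := F.m) (K' := J + (t + 1)) (j' := t + 1) (by omega)) B).tgt) ∧
                ∀ ν, (B10Eq27TorusAxialLog.rel z ℓ'.src ν).natAbs ≤ 2)) →
      blockOf (b.src.shift b.dir) ≠ blockOf b.src →
      dist1 (corr ℰp (GaugeField.gaugeAct (g₀ (K - (J + (t + 1)))) (Averaging.iter (fun k => blockAvg (P := F.P K) (j := k) ℰp) (K - (J + (t + 1))) U₁)) ⟨blockOf b.src, b.dir⟩) ≤ 6 * ((((((F.P K).d + 2) * (F.P K).L : ℕ) : ℝ) ^ 2 / 4) * a t) :=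
    fun b _ _ => dist1_corr_le (ha0 t) hplaq' hthr' _
  have hρK : ∀ q : Plaq (F.P K) (K - (J + (t + 1))), (∃ b : PBond (F.P K) (K - (J + (t + 1))), (∃ ℓ' : PBond (F.P (J + (t + 1))) 0, (bondShift (F.sitesPerDir_eq (m := F.m) (K := J + (t + 1)) (j := 0) (m' := F.m) (K' := K) (j' := (K - (J + (t + 1)))) (by omega)) ℓ') = b ∧ (∃ z : Site (F.P (J + (t + 1))) 0,
                (B14.Eq22Determines.blockIter (t + 1) z = (bondShift (F.sitesPerDir_eq (m := F.m) (K := J) (j := 0) (m' := F.m) (K' := J + (t + 1)) (j' := t + 1) (by omega)) B).src ∨ B14.Eq22Determines.blockIter (t + 1) z = (bondShift (F.sitesPerDir_eq (m := F.m) (K := J) (j := 0) (m' := F.m) (K' := J + (t + 1)) (j' := t + 1) (by omega)) B).tgt) ∧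
                ∀ ν, (B10Eq27TorusAxialLog.rel z ℓ'.src ν).natAbs ≤ 2)) ∧
        (blockOf q.src = blockOf b.src ∨ blockOf q.src = (blockOf b.src).shift b.dir)) →
      dist1 ((GaugeField.plaqHol (fun b => lift (K - (J + (t + 1))) (GaugeField.gaugeAct (g ((K - (J + (t + 1))) + 1)) (Averaging.iter (fun k => blockAvg (P := F.P K) (j := k) ℰp) ((K - (J + (t + 1))) + 1) (fun ℓ => expPoint (ζ ℓ) * U₀ ℓ))) b *
            (lift (K - (J + (t + 1))) (GaugeField.gaugeAct (g₀ ((K - (J + (t + 1))) + 1)) (Averaging.iter (fun k => blockAvg (P := F.P K) (j := k) ℰp) ((K - (J + (t + 1))) + 1) U₁)) b)⁻¹ *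
          (GaugeField.gaugeAct (g₀ (K - (J + (t + 1)))) (Averaging.iter (fun k => blockAvg (P := F.P K) (j := k) ℰp) (K - (J + (t + 1))) U₁)) b : GaugeField (F.P K) (K - (J + (t + 1))) SU2) q)⁻¹ *
        GaugeField.plaqHol (GaugeField.gaugeAct (g (K - (J + (t + 1)))) (Averaging.iter (fun k => blockAvg (P := F.P K) (j := k) ℰp) (K - (J + (t + 1))) (fun ℓ => expPoint (ζ ℓ) * U₀ ℓ))) q) ≤ ρt t B := by
    rintro q ⟨b, ⟨ℓ', rfl, hread⟩, hq⟩
    exact hρ t ht B q ⟨ℓ', hread, hq⟩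
  -- THE FEEDBACK LETTER `mR := 11∕10·L⁻¹·M(t,B)`: by the top coincidence at `t = 0`, by the arc profile at the parent height for `t ≥ 1`
  have hR : ∀ b : PBond (F.P K) (K - (J + (t + 1))), (∃ ℓ' : PBond (F.P (J + (t + 1))) 0, (bondShift (F.sitesPerDir_eq (m := F.m) (K := J + (t + 1)) (j := 0) (m' := F.m) (K' := K) (j' := (K - (J + (t + 1)))) (by omega)) ℓ') = b ∧ (∃ z : Site (F.P (J + (t + 1))) 0,
                (B14.Eq22Determines.blockIter (t + 1) z = (bondShift (F.sitesPerDir_eq (m := F.m) (K := J) (j := 0) (m' := F.m) (K' := J + (t + 1)) (j' := t + 1) (by omega)) B).src ∨ B14.Eq22Determines.blockIter (t + 1) z = (bondShift (F.sitesPerDir_eq (m := F.m) (K := J) (j := 0) (m' := F.m) (K' := J + (t + 1)) (j' := t + 1) (by omega)) B).tgt) ∧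
                ∀ ν, (B10Eq27TorusAxialLog.rel z ℓ'.src ν).natAbs ≤ 2)) →
      blockOf (b.src.shift b.dir) ≠ blockOf b.src →
      dist1 (lift (K - (J + (t + 1))) (GaugeField.gaugeAct (g ((K - (J + (t + 1))) + 1)) (Averaging.iter (fun k => blockAvg (P := F.P K) (j := k) ℰp) ((K - (J + (t + 1))) + 1) (fun ℓ => expPoint (ζ ℓ) * U₀ ℓ)))
            ⟨transl (emb (blockOf b.src)) (fun ν => if ν = b.dir then ((((F.P K).L - 1) / 2 : ℕ) : ℤ) else 0), b.dir⟩ *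
          (lift (K - (J + (t + 1))) (GaugeField.gaugeAct (g₀ ((K - (J + (t + 1))) + 1)) (Averaging.iter (fun k => blockAvg (P := F.P K) (j := k) ℰp) ((K - (J + (t + 1))) + 1) U₁))
            ⟨transl (emb (blockOf b.src)) (fun ν => if ν = b.dir then ((((F.P K).L - 1) / 2 : ℕ) : ℤ) else 0), b.dir⟩)⁻¹) ≤
        11 / 10 * ((F.L : ℝ)⁻¹ * ‖(fun ℓ' : PBond (F.P (J + t)) 0 =>
              if ∃ z : Site (F.P (J + t)) 0,
                (B14.Eq22Determines.blockIter t z = (bondShift (F.sitesPerDir_eq (m := F.m) (K := J) (j := 0) (m' := F.m) (K' := J + t) (j' := t) (by omega)) B).src ∨ B14.Eq22Determines.blockIter t z = (bondShift (F.sitesPerDir_eq (m := F.m) (K := J) (j := 0) (m' := F.m) (K' := J + t) (j' := t) (by omega)) B).tgt) ∧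
                ∀ ν, (B10Eq27TorusAxialLog.rel z ℓ'.src ν).natAbs ≤ 2
              then logVec (su2Quat (descendTo F ℰp (J + t) K (by omega) (fun ℓ => expPoint (ζ ℓ) * U₀ ℓ : GaugeField (F.P K) 0 (Matrix.specialUnitaryGroup (Fin 2) ℂ)) ℓ' * (descendTo F ℰp (J + t) K (by omega) U₀ ℓ')⁻¹)) else 0)‖) := by
    rintro b ⟨ℓ'', rfl, z, hzB, hz2⟩ hx
    cases t with
    | zero =>
      -- on the fibre the two top stage fields coincide, so the relative lift is `1`
      have hs : K - (J + (0 + 1)) + 1 = K - J := by omega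
      have htop := stageTop_eq_of_fibreMate hJK U₀ ζ U₁ g g₀ hg1 hg1' hT6 hT5r hmate hU₀ (K - (J + (0 + 1))) hs
      have e1 : lift (K - (J + (0 + 1))) (GaugeField.gaugeAct (g ((K - (J + (0 + 1))) + 1)) (Averaging.iter (fun k => blockAvg (P := F.P K) (j := k) ℰp) ((K - (J + (0 + 1))) + 1) (fun ℓ => expPoint (ζ ℓ) * U₀ ℓ)))
            ⟨transl (emb (blockOf (bondShift (F.sitesPerDir_eq (m := F.m) (K := J + (0 + 1)) (j := 0) (m' := F.m) (K' := K) (j' := (K - (J + (0 + 1)))) (by omega)) ℓ'').src)) (fun ν => if ν = (bondShift (F.sitesPerDir_eq (m := F.m) (K := J + (0 + 1)) (j := 0) (m' := F.m) (K' := K) (j' := (K - (J + (0 + 1)))) (by omega)) ℓ'').dir then ((((F.P K).L - 1) / 2 : ℕ) : ℤ) else 0), (bondShift (F.sitesPerDir_eq (m := F.m) (K := J + (0 + 1)) (j := 0) (m' := F.m) (K' := K) (j' := (K - (J + (0 + 1)))) (by omega)) ℓ'').dir⟩ *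
          (lift (K - (J + (0 + 1))) (GaugeField.gaugeAct (g₀ ((K - (J + (0 + 1))) + 1)) (Averaging.iter (fun k => blockAvg (P := F.P K) (j := k) ℰp) ((K - (J + (0 + 1))) + 1) U₁))
            ⟨transl (emb (blockOf (bondShift (F.sitesPerDir_eq (m := F.m) (K := J + (0 + 1)) (j := 0) (m' := F.m) (K' := K) (j' := (K - (J + (0 + 1)))) (by omega)) ℓ'').src)) (fun ν => if ν = (bondShift (F.sitesPerDir_eq (m := F.m) (K := J + (0 + 1)) (j := 0) (m' := F.m) (K' := K) (j' := (K - (J + (0 + 1)))) (by omega)) ℓ'').dir then ((((F.P K).L - 1) / 2 : ℕ) : ℤ) else 0), (bondShift (F.sitesPerDir_eq (m := F.m) (K := J + (0 + 1)) (j := 0) (m' := F.m) (K' := K) (j' := (K - (J + (0 + 1)))) (by omega)) ℓ'').dir⟩)⁻¹ = 1 := by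
        rw [htop, mul_inv_cancel]
      rw [e1]
      exact le_of_eq_of_le (GaugeGroup.dist1_one) hM0
    | succ t =>
      -- the relative lift at the central bond reads the parent bond only (✓`feeder_b0`), whose stage chord is an entry of `M(t+1,B)` (§1)
      have hs1d : K - (J + (t + 1 + 1)) + 1 = K - (J + (t + 1)) := by omega
      have P₁ : (F.P (J + (t + 1))).sitesPerDir 0 = (F.P K).sitesPerDir (K - (J + (t + 1 + 1)) + 1) := F.sitesPerDir_eq (by omega)
      rw [centralBond_eq_b0]
      refine (dist1_le_norm_logVec _).trans ?_
      refine norm_logVec_liftChord_le_eleven_tenths hsK (wt _) (hwt _)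
        (GaugeField.gaugeAct (g ((K - (J + (t + 1 + 1))) + 1)) (Averaging.iter (fun k => blockAvg (P := F.P K) (j := k) ℰp) ((K - (J + (t + 1 + 1))) + 1) (fun ℓ => expPoint (ζ ℓ) * U₀ ℓ)))
        (GaugeField.gaugeAct (g₀ ((K - (J + (t + 1 + 1))) + 1)) (Averaging.iter (fun k => blockAvg (P := F.P K) (j := k) ℰp) ((K - (J + (t + 1 + 1))) + 1) U₁)) _ _
        (fun b' => hlift _ (GaugeField.gaugeAct (g ((K - (J + (t + 1 + 1))) + 1)) (Averaging.iter (fun k => blockAvg (P := F.P K) (j := k) ℰp) ((K - (J + (t + 1 + 1))) + 1) (fun ℓ => expPoint (ζ ℓ) * U₀ ℓ))) b')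
        (fun b' => hlift _ (GaugeField.gaugeAct (g₀ ((K - (J + (t + 1 + 1))) + 1)) (Averaging.iter (fun k => blockAvg (P := F.P K) (j := k) ℰp) ((K - (J + (t + 1 + 1))) + 1) U₁)) b')
        (b0 ⟨blockOf (bondShift (F.sitesPerDir_eq (m := F.m) (K := J + (t + 1 + 1)) (j := 0) (m' := F.m) (K' := K) (j' := (K - (J + (t + 1 + 1)))) (by omega)) ℓ'').src, (bondShift (F.sitesPerDir_eq (m := F.m) (K := J + (t + 1 + 1)) (j := 0) (m' := F.m) (K' := K) (j' := (K - (J + (t + 1 + 1)))) (by omega)) ℓ'').dir⟩) hL2' hσ4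
        (feeder_b0 hsK (wt _) (hwt _) _ (hQ := (hArc (K - (J + (t + 1 + 1)) + 1) (by omega) (by omega) _).1))
        (feeder_b0 hsK (wt _) (hwt _) _ (hQ := (hArc (K - (J + (t + 1 + 1)) + 1) (by omega) (by omega) _).2))
        (feeder_b0 hsK (wt _) (hwt _) _ (hQ := ?_))
      -- the parent's stage chord = raw chord = the descended relative field one family down, an entry of `M(t+1,B)`
      rw [← norm_logVec_rawChord_eq_stageChord (fun k => blockAvg (P := F.P K) (j := k) ℰp) g g₀ (fun ℓ => expPoint (ζ ℓ) * U₀ ℓ) U₁ U₀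
        (fun X => hT3 X _ hs1le) (fun X => hT3' X _ hs1le) hU₀]
      obtain ⟨hxz, hy2⟩ := read'_parent (F := F) (n := J + (t + 1)) (K := K) (s := K - (J + (t + 1 + 1))) (by omega) (by omega) hsK ℓ'' hz2
      refine le_trans (le_of_eq ?_) (norm_le_pi_norm _ ((bondShift P₁).symm ⟨blockOf (bondShift (F.sitesPerDir_eq (m := F.m) (K := J + (t + 1 + 1)) (j := 0) (m' := F.m) (K' := K) (j' := (K - (J + (t + 1 + 1)))) (by omega)) ℓ'').src, (bondShift (F.sitesPerDir_eq (m := F.m) (K := J + (t + 1 + 1)) (j := 0) (m' := F.m) (K' := K) (j' := (K - (J + (t + 1 + 1)))) (by omega)) ℓ'').dir⟩))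
      have hREADc : ∃ z' : Site (F.P (J + (t + 1))) 0,
          (B14.Eq22Determines.blockIter (t + 1) z' = (bondShift (F.sitesPerDir_eq (m := F.m) (K := J) (j := 0) (m' := F.m) (K' := J + (t + 1)) (j' := t + 1) (by omega)) B).src ∨ B14.Eq22Determines.blockIter (t + 1) z' = (bondShift (F.sitesPerDir_eq (m := F.m) (K := J) (j := 0) (m' := F.m) (K' := J + (t + 1)) (j' := t + 1) (by omega)) B).tgt) ∧
          ∀ ν, (B10Eq27TorusAxialLog.rel z' ((bondShift P₁).symm ⟨blockOf (bondShift (F.sitesPerDir_eq (m := F.m) (K := J + (t + 1 + 1)) (j := 0) (m' := F.m) (K' := K) (j' := (K - (J + (t + 1 + 1)))) (by omega)) ℓ'').src, (bondShift (F.sitesPerDir_eq (m := F.m) (K := J + (t + 1 + 1)) (j := 0) (m' := F.m) (K' := K) (j' := (K - (J + (t + 1 + 1)))) (by omega)) ℓ'').dir⟩).src ν).natAbs ≤ 2 := by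
        refine ⟨_, ?_, hy2⟩
        have H := blockIter_succ_eq_siteShift (K₁ := J + (t + 1)) _ z hxz (t + 1)
        rcases hzB with h | h
        · left; rw [bondShift_src] at h ⊢
          exact (siteShift _).injective ((H.symm.trans h).trans (by rw [siteShift_siteShift]))
        · right; rw [bondShift_tgt] at h ⊢
          exact (siteShift _).injective ((H.symm.trans h).trans (by rw [siteShift_siteShift]))
      split_ifs with h1
      · rw [descendTo_apply_eq_iter_of_eq F (n := J + (t + 1)) (by omega) hs1d (fun ℓ => expPoint (ζ ℓ) * U₀ ℓ) _,
          descendTo_apply_eq_iter_of_eq F (n := J + (t + 1)) (by omega) hs1d U₀ _, Equiv.apply_symm_apply]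
        rfl
      · exact absurd hREADc h1
  -- THE PER-`B` ROW (px5 Q11l §3) with these letters, and the transfer `‖D′-summand‖ ≤ ‖its pS-form‖` (pointwise, bond by bond)
  have key := sq_pi_norm_disc_trunc_le_source_add_feedback ℰp hsK wt lift g g₀ (fun ℓ => expPoint (ζ ℓ) * U₀ ℓ) U₁ (hwt _) (fun X b => hlift _ X b)
    (hT4 _ hslt) (hT4' _ hslt) hT5 hT5' hcomm
    (fun b : PBond (F.P K) (K - (J + (t + 1))) => ∃ ℓ' : PBond (F.P (J + (t + 1))) 0, (bondShift (F.sitesPerDir_eq (m := F.m) (K := J + (t + 1)) (j := 0) (m' := F.m) (K' := K) (j' := (K - (J + (t + 1)))) (by omega)) ℓ') = b ∧ (∃ z : Site (F.P (J + (t + 1))) 0,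
                (B14.Eq22Determines.blockIter (t + 1) z = (bondShift (F.sitesPerDir_eq (m := F.m) (K := J) (j := 0) (m' := F.m) (K' := J + (t + 1)) (j' := t + 1) (by omega)) B).src ∨ B14.Eq22Determines.blockIter (t + 1) z = (bondShift (F.sitesPerDir_eq (m := F.m) (K := J) (j := 0) (m' := F.m) (K' := J + (t + 1)) (j' := t + 1) (by omega)) B).tgt) ∧
                ∀ ν, (B10Eq27TorusAxialLog.rel z ℓ'.src ν).natAbs ≤ 2))
    (hρκ0 t B) haκ0 hM0 (hρt0 t B) hκrelK hκabsK hR hρK hκ'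
  refine le_trans (pow_le_pow_left₀ (norm_nonneg _) ((pi_norm_le_iff_of_nonneg (norm_nonneg _)).2 fun ℓ'' => ?_) 2) (key.trans (le_of_eq ?_))
  · by_cases hD : (∃ z : Site (F.P (J + (t + 1))) 0,
                (B14.Eq22Determines.blockIter (t + 1) z = (bondShift (F.sitesPerDir_eq (m := F.m) (K := J) (j := 0) (m' := F.m) (K' := J + (t + 1)) (j' := t + 1) (by omega)) B).src ∨ B14.Eq22Determines.blockIter (t + 1) z = (bondShift (F.sitesPerDir_eq (m := F.m) (K := J) (j := 0) (m' := F.m) (K' := J + (t + 1)) (j' := t + 1) (by omega)) B).tgt) ∧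
                ∀ ν, (B10Eq27TorusAxialLog.rel z ℓ''.src ν).natAbs ≤ 2) ∧
                ¬ (blockOf (ℓ''.src.shift ℓ''.dir) = blockOf ℓ''.src ∧ ∀ ν, ν < ℓ''.dir → B10Eq27TorusAxialLog.rel (emb (blockOf ℓ''.src)) ℓ''.src ν = 0)
    · have hQ : (∃ ℓ' : PBond (F.P (J + (t + 1))) 0, (bondShift (F.sitesPerDir_eq (m := F.m) (K := J + (t + 1)) (j := 0) (m' := F.m) (K' := K) (j' := (K - (J + (t + 1)))) (by omega)) ℓ') = (bondShift (F.sitesPerDir_eq (m := F.m) (K := J + (t + 1)) (j := 0) (m' := F.m) (K' := K) (j' := (K - (J + (t + 1)))) (by omega)) ℓ'') ∧ (∃ z : Site (F.P (J + (t + 1))) 0,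
                (B14.Eq22Determines.blockIter (t + 1) z = (bondShift (F.sitesPerDir_eq (m := F.m) (K := J) (j := 0) (m' := F.m) (K' := J + (t + 1)) (j' := t + 1) (by omega)) B).src ∨ B14.Eq22Determines.blockIter (t + 1) z = (bondShift (F.sitesPerDir_eq (m := F.m) (K := J) (j := 0) (m' := F.m) (K' := J + (t + 1)) (j' := t + 1) (by omega)) B).tgt) ∧
                ∀ ν, (B10Eq27TorusAxialLog.rel z ℓ'.src ν).natAbs ≤ 2)) ∧
          ¬ (blockOf ((bondShift (F.sitesPerDir_eq (m := F.m) (K := J + (t + 1)) (j := 0) (m' := F.m) (K' := K) (j' := (K - (J + (t + 1)))) (by omega)) ℓ'').src.shift (bondShift (F.sitesPerDir_eq (m := F.m) (K := J + (t + 1)) (j := 0) (m' := F.m) (K' := K) (j' := (K - (J + (t + 1)))) (by omega)) ℓ'').dir) = blockOf (bondShift (F.sitesPerDir_eq (m := F.m) (K := J + (t + 1)) (j := 0) (m' := F.m) (K' := K) (j' := (K - (J + (t + 1)))) (by omega)) ℓ'').src ∧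
              ∀ ν, ν < (bondShift (F.sitesPerDir_eq (m := F.m) (K := J + (t + 1)) (j := 0) (m' := F.m) (K' := K) (j' := (K - (J + (t + 1)))) (by omega)) ℓ'').dir → rel (emb (blockOf (bondShift (F.sitesPerDir_eq (m := F.m) (K := J + (t + 1)) (j := 0) (m' := F.m) (K' := K) (j' := (K - (J + (t + 1)))) (by omega)) ℓ'').src)) (bondShift (F.sitesPerDir_eq (m := F.m) (K := J + (t + 1)) (j := 0) (m' := F.m) (K' := K) (j' := (K - (J + (t + 1)))) (by omega)) ℓ'').src ν = 0) := by
        refine ⟨⟨ℓ'', rfl, hD.1⟩, fun hc => hD.2 ?_⟩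
        have h := treeComb_siteShift P₂.symm Q₁.symm (siteShift P₂ ℓ''.src) ℓ''.dir hc.1 hc.2
        rwa [siteShift_symm_siteShift] at h
      refine le_trans (le_of_eq ?_) (norm_le_pi_norm _ (bondShift (F.sitesPerDir_eq (m := F.m) (K := J + (t + 1)) (j := 0) (m' := F.m) (K' := K) (j' := (K - (J + (t + 1)))) (by omega)) ℓ''))
      rw [if_pos hD]
      split_ifs with h1
      · rfl
      · exact absurd hQ h1
    · rw [if_neg hD, norm_zero]
      exact norm_nonneg _
  · rfl


/-! ## §3 The feedback's `S′`-share: `Σ_t L^t·Σ_B M(t,B)² ≤ L·S′` (RULING «β_X» (b)) -/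

/-- ★★ **THE `S′`-SHARE OF THE FEEDBACK COLUMN.**  With `M(t,B)` the parent READ′ Pi-sup of ✓`discRow'` and `S′ = Σ_{t<K−J} L^t·E′lam t` the station's READ′ sum
VERBATIM: `Σ_{t<K−J} L^t·(if t < K−J then Σ_B M(t,B)² else 0) ≤ L·S′` (the `L^t·X t` shape of ✓`hSCT_of_discSplit'`'s `hX′`) — the `t+1` summand is `L·(L^t·E′lam t)` by the letter of the text, the `t = 0` summand vanishes on the fibre
(`hmate`: the two level-`J` fields coincide).  Hence the `m²`-column of `X` contributes `β_X·S′` with `β_X = (1+κ′⁻¹)·(π·6·((5L)²∕4·ā)·((L−1)∕2+1)·(11∕10))²·L⁻¹`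
once `a t ≤ ā` (the knit's arithmetic). [cite: Balaban1985Averaging, Prop. 4 (128)-(135) p.37-38; Balaban1987RG1, (0.11) p.253] -/
theorem mShare_le {J K : ℕ} (hJK : J ≤ K) (U₀ : GaugeField (F.P K) 0 (Matrix.specialUnitaryGroup (Fin 2) ℂ)) (ζ : PBond (F.P K) 0 → EuclideanSpace ℝ (Fin 3))
    (hmate : descendTo F ℰp J K hJK (fun ℓ => expPoint (ζ ℓ) * U₀ ℓ : GaugeField (F.P K) 0 (Matrix.specialUnitaryGroup (Fin 2) ℂ)) = descendTo F ℰp J K hJK U₀) :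
    ∑ t ∈ Finset.range (K - J), (F.L : ℝ) ^ t * (if ht : t < K - J then
          ∑ B : PBond (F.P J) 0,
            ‖(fun ℓ' : PBond (F.P (J + t)) 0 =>
              if ∃ z : Site (F.P (J + t)) 0,
                (B14.Eq22Determines.blockIter t z = (bondShift (F.sitesPerDir_eq (m := F.m) (K := J) (j := 0) (m' := F.m) (K' := J + t) (j' := t) (by omega)) B).src ∨ B14.Eq22Determines.blockIter t z = (bondShift (F.sitesPerDir_eq (m := F.m) (K := J) (j := 0) (m' := F.m) (K' := J + t) (j' := t) (by omega)) B).tgt) ∧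
                ∀ ν, (B10Eq27TorusAxialLog.rel z ℓ'.src ν).natAbs ≤ 2
              then logVec (su2Quat (descendTo F ℰp (J + t) K (by omega) (fun ℓ => expPoint (ζ ℓ) * U₀ ℓ : GaugeField (F.P K) 0 (Matrix.specialUnitaryGroup (Fin 2) ℂ)) ℓ' * (descendTo F ℰp (J + t) K (by omega) U₀ ℓ')⁻¹)) else 0)‖ ^ 2
        else 0) ≤
      (F.L : ℝ) * (∑ t ∈ Finset.range (K - J), (if ht : t < K - J then
          (F.L : ℝ) ^ t * ∑ B : PBond (F.P J) 0,
            ‖(fun ℓ' : PBond (F.P (J + (t + 1))) 0 =>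
              if ∃ z : Site (F.P (J + (t + 1))) 0,
                (B14.Eq22Determines.blockIter (t + 1) z = (bondShift (F.sitesPerDir_eq (m := F.m) (K := J) (j := 0) (m' := F.m) (K' := J + (t + 1)) (j' := t + 1) (by omega)) B).src ∨ B14.Eq22Determines.blockIter (t + 1) z = (bondShift (F.sitesPerDir_eq (m := F.m) (K := J) (j := 0) (m' := F.m) (K' := J + (t + 1)) (j' := t + 1) (by omega)) B).tgt) ∧
                ∀ ν, (B10Eq27TorusAxialLog.rel z ℓ'.src ν).natAbs ≤ 2
              then logVec (su2Quat (descendTo F ℰp (J + (t + 1)) K (by omega) (fun ℓ => expPoint (ζ ℓ) * U₀ ℓ : GaugeField (F.P K) 0 (Matrix.specialUnitaryGroup (Fin 2) ℂ)) ℓ' * (descendTo F ℰp (J + (t + 1)) K (by omega) U₀ ℓ')⁻¹)) else 0)‖ ^ 2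
        else 0)) := by
  rcases Nat.eq_zero_or_pos (K - J) with h0 | hpos
  · have hr : Finset.range (K - J) = ∅ := by rw [h0]; rfl
    rw [hr, Finset.sum_empty, Finset.sum_empty, mul_zero]
  obtain ⟨n, hn⟩ : ∃ n, K - J = n + 1 := ⟨K - J - 1, by omega⟩
  have hr : Finset.range (K - J) = Finset.range (n + 1) := by rw [hn]
  rw [hr, Finset.sum_range_succ', Finset.sum_range_succ, mul_add]
  have hJ0 : J + 0 ≤ K := by omega
  have hm0 : descendTo F ℰp (J + 0) K hJ0 (fun ℓ => expPoint (ζ ℓ) * U₀ ℓ : GaugeField (F.P K) 0 (Matrix.specialUnitaryGroup (Fin 2) ℂ)) =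
      descendTo F ℰp (J + 0) K hJ0 U₀ := hmate
  refine add_le_add (le_of_eq ?_) (le_trans (le_of_eq (?_ : _ = (0 : ℝ))) ?_)
  · -- the `t+1` summand is `L·(L^t·E′lam t)` by the letter of the text
    rw [Finset.mul_sum]
    refine Finset.sum_congr rfl fun i hi => ?_
    have hi' : i < n := Finset.mem_range.1 hi
    rw [dif_pos (by omega), dif_pos (by omega), pow_succ]
    ring
  · -- the `t = 0` summand vanishes on the fibre
    rw [dif_pos hpos]
    refine mul_eq_zero_of_right _ (Finset.sum_eq_zero fun B _ => ?_)
    rw [sq_eq_zero_iff, norm_eq_zero]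
    funext ℓ'
    split_ifs with h
    · rw [hm0, mul_inv_cancel, FluctuationComparisonRegPrIntLS2BetaWhitneyHatLift.logVec_su2Quat_one]
      rfl
    · rfl
  · rw [dif_pos (by omega)]
    positivity

end Tower

end Summit.QuantumFields.YangMills.Theorems.FluctuationComparisonRegPrIntLS2BetaLiftLadderDiscRowTower
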